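import Mathlib.NumberTheory.PrimeCounting
import Mathlib.Topology.Algebra.Order.Field
import Mathlib.LinearAlgebra.Matrix.GeneralLinearGroup.Card
import Mathlib.LinearAlgebra.Matrix.Trace
import Literature.NumberTheory.EllipticCurves.SupersingularDensity
import HarnessLib

/-!
# Density `0` of the supersingular primes (Serre) — proofs, part 1: the density calculus and the
# `GL₂(𝔽_q)` count

Topic `NumberTheory/EllipticCurves`; a `…Proofs` sibling (theorems only, nothing is defined;
D-0014 append protocol) of `Literature.NumberTheory.EllipticCurves.SupersingularDensity`, next to
`Literature.NumberTheory.EllipticCurves.SupersingularDensityProofs` (which discharges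
`WeierstrassCurve.infinite_goodOrdinaryPrimes` by an elementary argument).  This series of files
works towards the named fact `WeierstrassCurve.serre_supersingular_density_zero` (Serre 1981, §8,
Thm. 20 / Cor. 2: for `E/ℚ` without CM the supersingular primes have natural density `0`).

## The printed proof and what it needs (Serre, *Publ. Math. IHÉS* 54 (1981))

Serre, p. 123 (a) and p. 124: the set of `p` with `a_p = 0` "est de densité zéro" — take a prime
`ℓ`, the Galois representation on the `ℓ`-power torsion, `Tr(ρ_ℓ(σ_p)) = a_p` (eq. (238)/(239),
p. 188), the trace-zero locus `C` has measure zero in the (open, [40], [41]) image `G_ℓ`, and the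
"théorème de Chebotarev qualitatif" (§2.1, Thm. 1, p. 131 — density meaning **natural** density,
`lim π_C(x)/π_K(x)`, eq. (9)) concludes.  By Remarque 1 (p. 190) one may instead use the mod-`ℓ`
representations `φ_ℓ : Γ_ℚ → GL₂(𝔽_ℓ)` with `ℓ` variable: when `φ_ℓ` is surjective (Serre 1972,
the tree's named fact `Literature.NumberTheory.EllipticCurves.serre_open_image`, for all large `ℓ`
when `E` has no CM) the supersingular primes `p ∤ 6ℓN_E` have Frobenius in
`C_ℓ = {g ∈ GL₂(𝔽_ℓ) : tr g = 0}`, a conjugation-stable set with `#C_ℓ / #GL₂(𝔽_ℓ) ≤ 4/ℓ`, so by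
Chebotarev their upper natural density is `≤ 4/ℓ` for every large `ℓ`, i.e. `0`.

This file proves the two elementary ends of that argument:

* the **density calculus** for `WeierstrassCurve.primeCountingRatio` / `WeierstrassCurve.HasPrimeDensity`
  (`SupersingularDensity`): finset form, `0 ≤ ratio ≤ 1`, monotonicity, subadditivity, finite sets
  have density `0` (`π(x) → ∞`, Mathlib `Nat.tendsto_primeCounting`), invariance under finitely
  many exceptions, and the squeeze
  `WeierstrassCurve.hasPrimeDensity_zero_of_forall_exists_superset`: *if for every `ε > 0` the set
  `S` lies, up to finitely many elements, in a set whose counting ratio is eventually `≤ ε`, then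
  `S` has natural density `0`* — the form in which "`≤ 4/ℓ` for all large `ℓ`" is consumed;
* the **count in `GL₂(𝔽_q)`**: the trace-zero invertible matrices inject into `𝔽_q³`
  (`natCard_traceZeroGL2_le`), `#GL₂(𝔽_q) = (q² - 1)(q² - q)` (Mathlib `Matrix.card_GL_field`)
  and hence `#{g ∈ GL₂(𝔽_q) : tr g = 0} / #GL₂(𝔽_q) ≤ 4/q`
  (`natCard_traceZeroGL2_div_le`; Serre's "dim C = 3 < 4 = dim G", p. 189, in its finite form);
* the arithmetic step `p ∣ a`, `a² ≤ 4p`, `p ≥ 5 ⇒ a = 0`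
  (`Literature.NumberTheory.EllipticCurves.eq_zero_of_natCast_dvd_of_sq_le`), turning the tree's
  `goodSupersingularPrimes` (`p ∣ a_p`) into Serre's `a_p = 0` through the Hasse bound.

What is **not** here (status recorded for the next files): the natural-density form of the
Chebotarev density theorem over `ℚ` is not in the tree (only the Dirichlet-density named fact
`Literature.NumberTheory.LFunctions.Chebotarev.dirichletDensity_eq`, which bounds lower, not
upper, natural densities) and `serre_open_image` is an undischarged named fact; the mod-`ℓ` trace of
Frobenius follows from the tree's theorem
`WeierstrassCurve.trace_galoisRepTate_frobenius_of_hasGoodReductionAt_holds`.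

## References

* [Serre1981] J.-P. Serre, *Quelques applications du théorème de densité de Chebotarev*, Publ.
  Math. IHÉS 54 (1981), 123–201 (held: `paper:doi-10-1007-bf02698692`): pp. 123–124 (a) and its
  proof sketch; §2.1 Thm. 1 and eq. (9) (p. 131); §8.1 eq. (238) (p. 188); Thm. 20, Cor. 2 and
  Remarque 1 (pp. 189–190).
-/

noncomputable section

open scoped Classical
open Filter Topology Finset

/-! ### The density calculus -/

namespace WeierstrassCurve

/-- The numerator of `primeCountingRatio S x` as a finset cardinality:
`#{p ≤ x : p prime, p ∈ S} = #((primesLE x).filter (· ∈ S))`. [folklore] -/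
theorem natCard_primesLE_mem_eq_card_filter (S : Set ℕ) (x : ℕ) :
    Nat.card {p : ℕ // p ≤ x ∧ p.Prime ∧ p ∈ S} = ((Nat.primesLE x).filter (· ∈ S)).card := by
  rw [← Nat.card_eq_finsetCard]
  exact Nat.card_congr (Equiv.subtypeEquivRight fun p => by
    simp only [mem_filter, Nat.mem_primesLE, and_assoc])

/-- The denominator of `primeCountingRatio S x` is `π(x)`. [folklore] -/
theorem natCard_primesLE_eq_primeCounting (x : ℕ) :
    Nat.card {p : ℕ // p ≤ x ∧ p.Prime} = Nat.primeCounting x := by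
  rw [← Nat.primesLE_card_eq_primeCounting, ← Nat.card_eq_finsetCard]
  exact Nat.card_congr (Equiv.subtypeEquivRight fun p => by simp only [Nat.mem_primesLE])

/-- Finset form of the counting ratio: `#((primesLE x).filter (· ∈ S)) / π(x)`. [folklore] -/
theorem primeCountingRatio_eq (S : Set ℕ) (x : ℕ) :
    primeCountingRatio S x =
      (((Nat.primesLE x).filter (· ∈ S)).card : ℝ) / (Nat.primeCounting x : ℝ) := by
  rw [primeCountingRatio, natCard_primesLE_mem_eq_card_filter, natCard_primesLE_eq_primeCounting]

/-- The counting ratio is nonnegative. [folklore] -/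
theorem primeCountingRatio_nonneg (S : Set ℕ) (x : ℕ) : 0 ≤ primeCountingRatio S x := by
  rw [primeCountingRatio_eq]
  positivity

/-- The counting ratio is at most `1`. [folklore] -/
theorem primeCountingRatio_le_one (S : Set ℕ) (x : ℕ) : primeCountingRatio S x ≤ 1 := by
  rw [primeCountingRatio_eq]
  rcases Nat.eq_zero_or_pos (Nat.primeCounting x) with h | h
  · simp [h]
  · rw [div_le_one (by exact_mod_cast h), ← Nat.primesLE_card_eq_primeCounting]
    exact_mod_cast card_filter_le _ _

/-- The counting ratio only sees primes and is monotone: if every prime of `S` lies in `T` then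
`ratio S ≤ ratio T`. [folklore] -/
theorem primeCountingRatio_mono {S T : Set ℕ} (h : ∀ p, p.Prime → p ∈ S → p ∈ T) (x : ℕ) :
    primeCountingRatio S x ≤ primeCountingRatio T x := by
  rw [primeCountingRatio_eq, primeCountingRatio_eq]
  refine div_le_div_of_nonneg_right ?_ (by positivity)
  have hsub : (Nat.primesLE x).filter (· ∈ S) ⊆ (Nat.primesLE x).filter (· ∈ T) := fun p hp => by
    simp only [mem_filter, Nat.mem_primesLE] at hp ⊢
    exact ⟨hp.1, h p hp.1.2 hp.2⟩
  exact_mod_cast card_le_card hsub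

/-- The counting ratio depends only on the primes in the set. [folklore] -/
theorem primeCountingRatio_congr {S T : Set ℕ} (h : ∀ p, p.Prime → (p ∈ S ↔ p ∈ T)) :
    primeCountingRatio S = primeCountingRatio T :=
  funext fun x => le_antisymm (primeCountingRatio_mono (fun p hp => (h p hp).1) x)
    (primeCountingRatio_mono (fun p hp => (h p hp).2) x)

/-- Subadditivity: `ratio (S ∪ T) ≤ ratio S + ratio T`. [folklore] -/
theorem primeCountingRatio_union_le (S T : Set ℕ) (x : ℕ) :
    primeCountingRatio (S ∪ T) x ≤ primeCountingRatio S x + primeCountingRatio T x := by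
  simp only [primeCountingRatio_eq, ← add_div]
  refine div_le_div_of_nonneg_right ?_ (by positivity)
  have key : ∀ A B C : Finset ℕ, (∀ p ∈ A, p ∈ B ∨ p ∈ C) → A.card ≤ B.card + C.card :=
    fun A B C hA => (card_le_card fun p hp => mem_union.2 (hA p hp)).trans (card_union_le B C)
  exact_mod_cast key _ _ _ fun p hp => by
    simp only [mem_filter, Set.mem_union] at hp ⊢
    tauto

/-- `ratio S ≤ ratio T + ratio (S \ T)`. [folklore] -/
theorem primeCountingRatio_le_add_diff (S T : Set ℕ) (x : ℕ) :
    primeCountingRatio S x ≤ primeCountingRatio T x + primeCountingRatio (S \ T) x :=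
  (primeCountingRatio_mono (T := T ∪ (S \ T)) (fun p _ hp => by
    by_cases h : p ∈ T
    · exact Or.inl h
    · exact Or.inr ⟨hp, h⟩) x).trans (primeCountingRatio_union_le T (S \ T) x)

/-- The counting ratio of `S` is bounded by `#F / π(x)` for any finite set `F ⊇ S`. [folklore] -/
theorem primeCountingRatio_le_card_div {S : Set ℕ} (hS : S.Finite) (x : ℕ) :
    primeCountingRatio S x ≤ (hS.toFinset.card : ℝ) / (Nat.primeCounting x : ℝ) := by
  rw [primeCountingRatio_eq]
  refine div_le_div_of_nonneg_right ?_ (by positivity)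
  have hsub : (Nat.primesLE x).filter (· ∈ S) ⊆ hS.toFinset := fun p hp => by
    simp only [mem_filter, Set.Finite.mem_toFinset] at hp ⊢
    exact hp.2
  exact_mod_cast card_le_card hsub

/-- **A finite set of primes has natural density `0`**: its counting function is bounded while
`π(x) → ∞` (Euclid; Mathlib `Nat.tendsto_primeCounting`). [folklore] -/
theorem tendsto_primeCountingRatio_of_finite {S : Set ℕ} (hS : S.Finite) :
    Tendsto (primeCountingRatio S) atTop (𝓝 0) := by
  have hlim : Tendsto (fun x => (hS.toFinset.card : ℝ) / (Nat.primeCounting x : ℝ)) atTop (𝓝 0) :=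
    tendsto_const_nhds.div_atTop (tendsto_natCast_atTop_atTop.comp Nat.tendsto_primeCounting)
  exact tendsto_of_tendsto_of_tendsto_of_le_of_le tendsto_const_nhds hlim
    (primeCountingRatio_nonneg S) (primeCountingRatio_le_card_div hS)

/-- A finite set has natural (prime) density `0`. [folklore] -/
theorem HasPrimeDensity.of_finite {S : Set ℕ} (hS : S.Finite) : HasPrimeDensity S 0 :=
  tendsto_primeCountingRatio_of_finite hS

/-- The natural density, when it exists, is unique. [folklore] -/
theorem HasPrimeDensity.unique {S : Set ℕ} {δ δ' : ℝ} (h : HasPrimeDensity S δ)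
    (h' : HasPrimeDensity S δ') : δ = δ' :=
  tendsto_nhds_unique h h'

/-- A natural density lies in `[0, 1]`: nonnegativity. [folklore] -/
theorem HasPrimeDensity.nonneg {S : Set ℕ} {δ : ℝ} (h : HasPrimeDensity S δ) : 0 ≤ δ :=
  ge_of_tendsto' h (primeCountingRatio_nonneg S)

/-- A natural density lies in `[0, 1]`: it is at most `1`. [folklore] -/
theorem HasPrimeDensity.le_one {S : Set ℕ} {δ : ℝ} (h : HasPrimeDensity S δ) : δ ≤ 1 :=
  le_of_tendsto' h (primeCountingRatio_le_one S)

/-- The natural density depends only on the primes in the set. [folklore] -/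
theorem HasPrimeDensity.congr {S T : Set ℕ} {δ : ℝ} (h : HasPrimeDensity S δ)
    (hST : ∀ p, p.Prime → (p ∈ S ↔ p ∈ T)) : HasPrimeDensity T δ := by
  unfold HasPrimeDensity at h ⊢
  rwa [← primeCountingRatio_congr hST]

/-- **Finitely many exceptions do not change the density**: if `S \ T` and `T \ S` are finite and
`T` has density `δ`, so does `S`. [folklore] -/
theorem HasPrimeDensity.of_finite_diff {S T : Set ℕ} {δ : ℝ} (hT : HasPrimeDensity T δ)
    (h₁ : (S \ T).Finite) (h₂ : (T \ S).Finite) : HasPrimeDensity S δ := by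
  have hlow : ∀ x, primeCountingRatio T x - primeCountingRatio (T \ S) x ≤ primeCountingRatio S x :=
    fun x => by linarith [primeCountingRatio_le_add_diff T S x]
  refine tendsto_of_tendsto_of_tendsto_of_le_of_le ?_ ?_ hlow (primeCountingRatio_le_add_diff S T)
  · simpa using hT.sub (tendsto_primeCountingRatio_of_finite h₂)
  · simpa using hT.add (tendsto_primeCountingRatio_of_finite h₁)

/-- Monotonicity of densities: if every prime of `S` lies in `T` then `δ_S ≤ δ_T`. [folklore] -/
theorem HasPrimeDensity.mono {S T : Set ℕ} {δ δ' : ℝ} (hS : HasPrimeDensity S δ)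
    (hT : HasPrimeDensity T δ') (h : ∀ p, p.Prime → p ∈ S → p ∈ T) : δ ≤ δ' :=
  le_of_tendsto_of_tendsto' hS hT (primeCountingRatio_mono h)

/-- **Squeeze to density zero.** If for every `ε > 0` the set `S` is contained, up to finitely many
elements, in a set `T` whose counting ratio is eventually `≤ ε`, then `S` has natural density `0`.
This is the shape in which Serre's argument is assembled ("`≤ 4/ℓ` for every large prime `ℓ`",
Serre 1981, p. 124 and Remarque 1, p. 190). [folklore] -/
theorem hasPrimeDensity_zero_of_forall_exists_superset {S : Set ℕ}
    (h : ∀ ε > (0 : ℝ), ∃ T : Set ℕ, (S \ T).Finite ∧ ∀ᶠ x in atTop, primeCountingRatio T x ≤ ε) :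
    HasPrimeDensity S 0 := by
  rw [HasPrimeDensity, Metric.tendsto_nhds]
  intro ε hε
  obtain ⟨T, hfin, hT⟩ := h (ε / 2) (half_pos hε)
  have h2 : ∀ᶠ x in atTop, primeCountingRatio (S \ T) x < ε / 2 :=
    (tendsto_primeCountingRatio_of_finite hfin).eventually (gt_mem_nhds (half_pos hε))
  filter_upwards [hT, h2] with x hx hx2
  rw [Real.dist_eq, sub_zero, abs_of_nonneg (primeCountingRatio_nonneg S x)]
  calc primeCountingRatio S x
      ≤ primeCountingRatio T x + primeCountingRatio (S \ T) x := primeCountingRatio_le_add_diff S T x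
    _ < ε / 2 + ε / 2 := add_lt_add_of_le_of_lt hx hx2
    _ = ε := add_halves ε

/-- **Squeeze to density zero, density form.** If for every `ε > 0` the set `S` is contained, up to
finitely many elements, in a set of natural density `< ε`, then `S` has natural density `0`.
[folklore] -/
theorem hasPrimeDensity_zero_of_forall_exists_hasPrimeDensity_lt {S : Set ℕ}
    (h : ∀ ε > (0 : ℝ), ∃ (T : Set ℕ) (δ : ℝ), HasPrimeDensity T δ ∧ δ < ε ∧ (S \ T).Finite) :
    HasPrimeDensity S 0 := by
  refine hasPrimeDensity_zero_of_forall_exists_superset fun ε hε => ?_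
  obtain ⟨T, δ, hT, hδ, hfin⟩ := h ε hε
  exact ⟨T, hfin, (hT.eventually (gt_mem_nhds hδ)).mono fun x hx => hx.le⟩

/-- A set contained, up to finitely many primes, in a set of density `0` has density `0`.
[folklore] -/
theorem HasPrimeDensity.zero_of_subset {S T : Set ℕ} (hT : HasPrimeDensity T 0)
    (h : {p ∈ S | p.Prime ∧ p ∉ T}.Finite) : HasPrimeDensity S 0 := by
  refine hasPrimeDensity_zero_of_forall_exists_hasPrimeDensity_lt fun ε hε =>
    ⟨T ∪ {p | ¬ p.Prime}, 0, ?_, hε, h.subset fun p hp => ?_⟩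
  · exact hT.congr fun p hp => by simp [hp]
  · simp only [Set.mem_sdiff, Set.mem_union, Set.mem_setOf_eq, not_or, not_not] at hp
    exact ⟨hp.1, hp.2.2, hp.2.1⟩

/-- Elements of `goodSupersingularPrimes W` are prime. [folklore] -/
theorem prime_of_mem_goodSupersingularPrimes {W : WeierstrassCurve ℚ} [W.IsGloballyMinimal] {p : ℕ}
    (hp : p ∈ W.goodSupersingularPrimes) : p.Prime := by
  obtain ⟨hp, -, -⟩ := hp
  exact hp.out

/-- Elements of `goodOrdinaryPrimes W` are prime. [folklore] -/
theorem prime_of_mem_goodOrdinaryPrimes {W : WeierstrassCurve ℚ} [W.IsGloballyMinimal] {p : ℕ}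
    (hp : p ∈ W.goodOrdinaryPrimes) : p.Prime := by
  obtain ⟨hp, -, -⟩ := hp
  exact hp.out

end WeierstrassCurve

namespace Literature.NumberTheory.EllipticCurves

/-! ### `p ∣ a_p` versus `a_p = 0` -/

/-- **Hasse turns `p ∣ a_p` into `a_p = 0` for `p ≥ 5`.** An integer `a` with `a² ≤ 4p` which is
divisible by `p ≥ 5` vanishes: otherwise `a² ≥ p² ≥ 5p > 4p`. (With `a = a_p` and the Hasse bound
`a_p² ≤ 4p` this is the equivalence "supersingular ⟺ `a_p = 0`" for `p ≥ 5`; Serre 1981, p. 123,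
"si `p ≠ 2`, on a `p ∈ S_E` si et seulement si la réduction de `E` en `p` est supersingulière".)
[folklore] -/
theorem eq_zero_of_natCast_dvd_of_sq_le {p : ℕ} (hp : 5 ≤ p) {a : ℤ} (ha : a ^ 2 ≤ 4 * p)
    (hdvd : (p : ℤ) ∣ a) : a = 0 := by
  obtain ⟨k, rfl⟩ := hdvd
  by_contra hk
  have hk' : k ≠ 0 := fun h => hk (by rw [h, mul_zero])
  have h1 : (1 : ℤ) ≤ k ^ 2 := by
    have := Int.one_le_abs hk'
    nlinarith [abs_nonneg k, sq_abs k]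
  have hp' : (5 : ℤ) ≤ p := by exact_mod_cast hp
  nlinarith [mul_pow (p : ℤ) k 2]

/-- Conversely `a = 0` is divisible by anything; recorded for symmetry of use. [folklore] -/
theorem natCast_dvd_iff_eq_zero_of_sq_le {p : ℕ} (hp : 5 ≤ p) {a : ℤ} (ha : a ^ 2 ≤ 4 * p) :
    (p : ℤ) ∣ a ↔ a = 0 :=
  ⟨eq_zero_of_natCast_dvd_of_sq_le hp ha, fun h => h ▸ dvd_zero _⟩

/-! ### Trace-zero elements of `GL₂(𝔽_q)` -/

section GL2

variable (F : Type*) [Field F] [Fintype F]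

omit [Fintype F] in
/-- The trace-zero locus `{g ∈ GL₂(F) : tr g = 0}` — the mod-`ℓ` shadow of Serre's
`C_ℓ = {s ∈ G_ℓ : Tr(s) = 0}` (Serre 1981, p. 124 and p. 189) — is stable under conjugation (the
trace is a class function), as Chebotarev's theorem requires. [folklore] -/
theorem conj_mem_traceZeroGL2 {g h : GL (Fin 2) F}
    (hh : h ∈ {g : GL (Fin 2) F | Matrix.trace (g : Matrix (Fin 2) (Fin 2) F) = 0}) :
    g * h * g⁻¹ ∈ {g : GL (Fin 2) F | Matrix.trace (g : Matrix (Fin 2) (Fin 2) F) = 0} := by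
  simp only [Set.mem_setOf_eq, Units.val_mul] at hh ⊢
  rw [Matrix.trace_mul_cycle, ← Units.val_mul, inv_mul_cancel, Units.val_one, Matrix.one_mul, hh]

/-- **At most `q³` invertible `2 × 2` matrices over `𝔽_q` have trace zero**: such a matrix is
determined by its entries `(0,0), (0,1), (1,0)` (the last one being `-` the first).  Serre's
"`dim C_ℓ ≤ 3`" (1981, p. 189) in finite form. [folklore] -/
theorem natCard_traceZeroGL2_le :
    Nat.card {g : GL (Fin 2) F | Matrix.trace (g : Matrix (Fin 2) (Fin 2) F) = 0} ≤
      Fintype.card F ^ 3 := by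
  let f : {g : GL (Fin 2) F | Matrix.trace (g : Matrix (Fin 2) (Fin 2) F) = 0} → F × F × F :=
    fun g =>
    ((g : GL (Fin 2) F) 0 0, (g : GL (Fin 2) F) 0 1, (g : GL (Fin 2) F) 1 0)
  have hf : Function.Injective f := by
    rintro ⟨g, hg⟩ ⟨g', hg'⟩ h
    simp only [f, Prod.mk.injEq] at h
    obtain ⟨h00, h01, h10⟩ := h
    simp only [Set.mem_setOf_eq, Matrix.trace_fin_two] at hg hg'
    have h11 : (g : Matrix (Fin 2) (Fin 2) F) 1 1 = (g' : Matrix (Fin 2) (Fin 2) F) 1 1 := by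
      have e1 : (g : Matrix (Fin 2) (Fin 2) F) 1 1 = -(g : Matrix (Fin 2) (Fin 2) F) 0 0 := by
        linear_combination hg
      have e2 : (g' : Matrix (Fin 2) (Fin 2) F) 1 1 = -(g' : Matrix (Fin 2) (Fin 2) F) 0 0 := by
        linear_combination hg'
      rw [e1, e2, show (g : Matrix (Fin 2) (Fin 2) F) 0 0 = g 0 0 from rfl, h00]
    refine Subtype.ext (Units.ext (Matrix.ext fun i j => ?_))
    fin_cases i <;> fin_cases j
    · exact h00
    · exact h01
    · exact h10
    · exact h11
  calc Nat.card {g : GL (Fin 2) F | Matrix.trace (g : Matrix (Fin 2) (Fin 2) F) = 0}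
      ≤ Nat.card (F × F × F) := Nat.card_le_card_of_injective f hf
    _ = Fintype.card F ^ 3 := by rw [Nat.card_eq_fintype_card]; simp [Fintype.card_prod]; ring

/-- `#GL₂(𝔽_q) = (q² - 1)(q² - q)` (Mathlib `Matrix.card_GL_field`). [folklore] -/
theorem natCard_GL2_eq :
    Nat.card (GL (Fin 2) F) = (Fintype.card F ^ 2 - 1) * (Fintype.card F ^ 2 - Fintype.card F) := by
  rw [Matrix.card_GL_field]
  simp [Fin.prod_univ_two]

/-- `#GL₂(𝔽_q) ≥ q⁴/4`, in the integer form `q⁴ ≤ 4 · #GL₂(𝔽_q)`. [folklore] -/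
theorem pow_four_le_four_mul_natCard_GL2 : Fintype.card F ^ 4 ≤ 4 * Nat.card (GL (Fin 2) F) := by
  rw [natCard_GL2_eq]
  have hq : 2 ≤ Fintype.card F := Fintype.one_lt_card
  set q := Fintype.card F with hqdef
  have h1 : q ^ 2 ≤ 2 * (q ^ 2 - 1) := by
    have : 1 ≤ q ^ 2 := Nat.one_le_pow _ _ (by omega)
    zify [this]
    nlinarith
  have h2 : q ^ 2 ≤ 2 * (q ^ 2 - q) := by
    have : q ≤ q ^ 2 := by nlinarith
    zify [this]
    nlinarith
  calc q ^ 4 = q ^ 2 * q ^ 2 := by ring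
    _ ≤ (2 * (q ^ 2 - 1)) * (2 * (q ^ 2 - q)) := Nat.mul_le_mul h1 h2
    _ = 4 * ((q ^ 2 - 1) * (q ^ 2 - q)) := by ring

/-- **The proportion of trace-zero elements of `GL₂(𝔽_q)` is at most `4/q`** — the finite-level
form of "`C_ℓ` est de mesure nulle dans `G_ℓ`" (Serre 1981, p. 124) used along Remarque 1
(p. 190) with `ℓ → ∞`. [cite: Serre1981, §8 Remarque 1 (p. 190)] -/
theorem natCard_traceZeroGL2_div_le :
    (Nat.card {g : GL (Fin 2) F | Matrix.trace (g : Matrix (Fin 2) (Fin 2) F) = 0} : ℝ) /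
        Nat.card (GL (Fin 2) F) ≤ 4 / Fintype.card F := by
  have hq : (0 : ℝ) < Fintype.card F := by exact_mod_cast Fintype.card_pos
  have hG : (0 : ℝ) < Nat.card (GL (Fin 2) F) := by
    exact_mod_cast (Nat.card_pos (α := GL (Fin 2) F))
  rw [div_le_div_iff₀ hG hq]
  have h1 : (Nat.card {g : GL (Fin 2) F | Matrix.trace (g : Matrix (Fin 2) (Fin 2) F) = 0} : ℝ) ≤
      (Fintype.card F : ℝ) ^ 3 := by
    exact_mod_cast natCard_traceZeroGL2_le F
  have h2 : (Fintype.card F : ℝ) ^ 4 ≤ 4 * Nat.card (GL (Fin 2) F) := by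
    exact_mod_cast pow_four_le_four_mul_natCard_GL2 F
  nlinarith

end GL2

end Literature.NumberTheory.EllipticCurves
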